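import Literature.Analysis.FluidPDE.NormalisedPressureDischarge
import Literature.Analysis.FluidPDE.NormalisedPressureL2Bound
import Literature.Analysis.FluidPDE.NormalisedPressurePV
import HarnessLib

/-!
# Tao (2011/2013), Lemma 8.1: the energy bound for finite energy smooth solutions — assembly

Sibling of `FluidPDE/NSFiniteEnergySmooth` (the named fact
`NS.tao_finite_energy_smooth_energy_bound`: Tao 2011 = arXiv:1108.1165, **Lemma 8.1**, for a
classical finite energy solution of Navier–Stokes on `[0,T] × ℝ³`,
`½∫|u(t)|² + ν∫₀ᵗ∫|∇u|² ≤ ½∫|u₀|²`). The discharge was decomposed along the printed proof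
(§8, (53)–(65)) into

* layer 1 `TaoEnergyLocalisation` — the localised energy inequality (65) implies the fact
  (monotone convergence as the cutoff radius `R → ∞`);
* layer 2 `TaoEnergyLocalisationProofs` — (65) from the localised energy balance (61), the
  transport and viscous terms (62)–(63) (Hölder, Gagliardo–Nirenberg–Sobolev, Young), Tao's
  pressure normalisation (Lemma 4.1 (i), `NS.tao_pressure_normalisation`) and the estimate of the
  pressure term `X₅` (`NS.tao2011_pressureTerm_estimate`);
* layer 3 `TaoEnergyLocalisationPressure` — the estimate of `X₅ = X₅,₁ + X₅,₂` (with the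
  printed commutator bound repaired) from the existence of the principal values
  (`NS.hasPressurePV_of_contDiff`) and the `L²` bound of the Riesz-type singular integral
  (`NS.stein1970_normalisedPressure_eLpNorm_le`, Stein 1970 Ch. II §4.2 Thm 3);
* layer 4 `NormalisedPressureL2Bound` — PROOF of the `L²` bound (Newtonian potential,
  Hessian–Laplacian identity, Young, Fatou);
* layer 5 `NormalisedPressurePV` — PROOF of the existence of the principal values (zero
  spherical means, Lipschitz cancellation).

Hence Tao's Lemma 8.1 is reduced to Tao's Lemma 4.1 (i) alone:

  `tao_finite_energy_smooth_energy_bound_of_pressure_normalisation :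
     tao_pressure_normalisation → tao_finite_energy_smooth_energy_bound`.

## Main statements

* `truncatedPressureIntegral_bound_holds` — discharge of F1b (`A = 8`).
* `tao_finite_energy_smooth_energy_bound_of_pressure_normalisation` — Lemma 8.1 from Lemma 4.1 (i).
* `tao_finite_energy_smooth_energy_bound_holds` — **the discharge of Lemma 8.1**, now that
  Lemma 4.1 (i) is a theorem of the tree (`tao_pressure_normalisation_holds`,
  `FluidPDE/NormalisedPressureDischarge`).

`NS.tao_pressure_normalisation` (Tao 2011, Lemma 4.1 (i): for an almost smooth finite energy
solution, `p = -Δ⁻¹∂ᵢ∂ⱼ(uᵢuⱼ) + C(t)` for a.e. `t`) is a separate named fact of the tree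
(`FluidPDE/NormalisedPressure`), with its own decomposition in `FluidPDE/NormalisedPressureProofs`
(inputs F0–F4; F1 is `NS.hasPressurePV_of_contDiff`, discharged in layer 5; F1b
`NS.truncatedPressureIntegral_bound` is discharged here as a cheap by-product of layer 5
(`truncatedPressureIntegral_bound_holds`); F4 is proved in `FluidPDE/HarmonicMeanValue`) and its
proof in `FluidPDE/NormalisedPressureDischarge` (`tao_pressure_normalisation_holds`), which this
file imports for the final discharge `tao_finite_energy_smooth_energy_bound_holds`.

## References

* T. Tao, *Localisation and compactness properties of the Navier–Stokes global regularity
  problem*, Anal. PDE 6 (2013) 25–107 = arXiv:1108.1165 (`Tao2011`): Lemma 8.1 and its proof,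
  §8 (53)–(65); Lemma 4.1 (i).
* E. M. Stein, *Singular integrals and differentiability properties of functions* (1970)
  (`Stein1971`): Ch. II §4.2 Thm 3, Ch. III §1.
-/

noncomputable section

open MeasureTheory Set Filter Topology Metric
open scoped ENNReal RealInnerProductSpace ContDiff

namespace Literature.Analysis.FluidPDE

/-! ## A cheap by-product: the uniform bound for the truncated singular integrals (F1b) -/

/-- **Discharge of `NS.truncatedPressureIntegral_bound`** (input F1b of
`NormalisedPressureProofs`; Stein 1970, Ch. II §4: "`p₀` is bounded on compact subsets"): with
`A = 8`, for `C¹` finite-energy `v`, `|v| ≤ M₀` and `‖Dv‖ ≤ M₁` on `B̄(x,1)`, and `0 < ε ≤ 1`,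
`|∫_{|x-y|>ε} K(x-y)(v(y)) dy| ≤ 8 (M₀M₁ + M₀² + ∫|v|²)`: the far field `|x-y| > 1` is at most
`∫|v|²/(2π)` (`|K(z)(a)| ≤ |a|²/(2π|z|³)`), the shell `ε < |x-y| ≤ 1` at most `8M₀M₁(1-ε)`
(`NormalisedPressurePV.abs_setIntegral_shell_le`). [cite: Stein1971, Ch. II §4] -/
theorem truncatedPressureIntegral_bound_holds : truncatedPressureIntegral_bound := by
  refine ⟨8, fun v hv hE x M₀ M₁ hM₀ hM₁ ε hε => ?_⟩
  have hv2 : Integrable fun y => ‖v y‖ ^ 2 :=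
    integrable_sq_of_lintegral_enorm_sq_lt_top hv.continuous hE
  have hM₀0 : 0 ≤ M₀ := (norm_nonneg _).trans (hM₀ x (mem_closedBall_self zero_le_one))
  have hM₁0 : 0 ≤ M₁ := (norm_nonneg _).trans (hM₁ x (mem_closedBall_self zero_le_one))
  -- the Lipschitz bound on the ball from the derivative bound
  have hLip : ∀ y ∈ closedBall x 1, ‖v y - v x‖ ≤ M₁ * ‖y - x‖ := fun y hy =>
    (convex_closedBall x 1).norm_image_sub_le_of_norm_fderiv_le
      (fun z _ => hv.differentiable one_ne_zero z) hM₁ (mem_closedBall_self zero_le_one) hy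
  -- the energy in real form
  have hEreal : (∫⁻ y, ‖v y‖ₑ ^ 2).toReal = ∫ y, ‖v y‖ ^ 2 := by
    rw [← ofReal_integral_norm_sq_eq_lintegral hv2, ENNReal.toReal_ofReal]
    exact integral_nonneg fun y => sq_nonneg _
  -- far field: `|T_1| ≤ ∫|v|²/(2π)`
  have hfar : |truncatedPressureIntegral v x 1| ≤ (∫ y, ‖v y‖ ^ 2) / (2 * Real.pi) := by
    rw [truncatedPressureIntegral]
    have hint := integrableOn_pressureKernel_compl_closedBall hv.continuous hv2 x one_pos
    have hmaj : IntegrableOn (fun y => ‖v y‖ ^ 2 / (2 * Real.pi)) (closedBall x 1)ᶜ :=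
      (hv2.div_const _).integrableOn
    calc |∫ y in (closedBall x 1)ᶜ, pressureKernel (x - y) (v y)|
        ≤ ∫ y in (closedBall x 1)ᶜ, |pressureKernel (x - y) (v y)| := abs_integral_le_integral_abs
      _ ≤ ∫ y in (closedBall x 1)ᶜ, ‖v y‖ ^ 2 / (2 * Real.pi) := by
          refine setIntegral_mono_on hint.abs hmaj measurableSet_closedBall.compl fun y hy => ?_
          rw [mem_compl_iff, mem_closedBall, not_le, dist_eq_norm, ← norm_neg, neg_sub] at hy
          calc |pressureKernel (x - y) (v y)| ≤ ‖v y‖ ^ 2 / (2 * Real.pi * ‖x - y‖ ^ 3) :=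
                abs_pressureKernel_le _ _
            _ ≤ ‖v y‖ ^ 2 / (2 * Real.pi * 1 ^ 3) := by gcongr
            _ = ‖v y‖ ^ 2 / (2 * Real.pi) := by rw [one_pow, mul_one]
      _ ≤ ∫ y, ‖v y‖ ^ 2 / (2 * Real.pi) :=
          setIntegral_le_integral (hv2.div_const _) (Eventually.of_forall fun y => by positivity)
      _ = (∫ y, ‖v y‖ ^ 2) / (2 * Real.pi) := integral_div _ _
  -- shell: `|T_ε - T_1| ≤ 8 M₀M₁(1 - ε)`
  have hshell : |truncatedPressureIntegral v x ε - truncatedPressureIntegral v x 1| ≤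
      8 * M₀ * M₁ * (1 - ε) :=
    abs_truncatedPressureIntegral_sub_le hv hv2 hM₀ hLip hM₁0 hε.1 hε.2 le_rfl
  -- assemble
  have hπ : (∫ y, ‖v y‖ ^ 2) / (2 * Real.pi) ≤ ∫ y, ‖v y‖ ^ 2 := by
    rw [div_le_iff₀ (by positivity)]
    have h0 : 0 ≤ ∫ y, ‖v y‖ ^ 2 := integral_nonneg fun y => sq_nonneg _
    nlinarith [Real.pi_gt_three]
  rw [hEreal]
  calc |truncatedPressureIntegral v x ε|
      = |(truncatedPressureIntegral v x ε - truncatedPressureIntegral v x 1) +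
          truncatedPressureIntegral v x 1| := by rw [sub_add_cancel]
    _ ≤ 8 * M₀ * M₁ * (1 - ε) + (∫ y, ‖v y‖ ^ 2) / (2 * Real.pi) :=
        (abs_add_le _ _).trans (add_le_add hshell hfar)
    _ ≤ 8 * (M₀ * M₁ + M₀ ^ 2 + ∫ y, ‖v y‖ ^ 2) := by
        have h1 : 8 * M₀ * M₁ * (1 - ε) ≤ 8 * (M₀ * M₁) := by nlinarith [hε.1, mul_nonneg hM₀0 hM₁0]
        have h0 : 0 ≤ ∫ y, ‖v y‖ ^ 2 := integral_nonneg fun y => sq_nonneg _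
        nlinarith [sq_nonneg M₀]

/-! ## Tao's Lemma 8.1 from Lemma 4.1 (i) -/

/-- **Tao 2011, Lemma 8.1, from Lemma 4.1 (i).** The energy bound for finite energy smooth
solutions of Navier–Stokes on `ℝ³` (`NS.tao_finite_energy_smooth_energy_bound`) follows from
Tao's pressure normalisation `NS.tao_pressure_normalisation` alone: the two singular-integral
inputs of layer 3 are theorems (`hasPressurePV_of_contDiff_holds`,
`stein1970_normalisedPressure_eLpNorm_le_holds`). [cite: Tao2011, Lemma 8.1] -/
theorem tao_finite_energy_smooth_energy_bound_of_pressure_normalisation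
    (hP : tao_pressure_normalisation) : tao_finite_energy_smooth_energy_bound :=
  tao_finite_energy_smooth_energy_bound_of_pv hP hasPressurePV_of_contDiff_holds

/-- The same statement with all three classical inputs of layer 3 made explicit and the two
discharged ones supplied, for readers tracing the dependency graph. [cite: Tao2011, Lemma 8.1] -/
theorem tao_finite_energy_smooth_energy_bound_inputs :
    hasPressurePV_of_contDiff ∧ stein1970_normalisedPressure_eLpNorm_le ∧
      (tao_pressure_normalisation → tao_finite_energy_smooth_energy_bound) :=
  ⟨hasPressurePV_of_contDiff_holds, stein1970_normalisedPressure_eLpNorm_le_holds,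
    tao_finite_energy_smooth_energy_bound_of_pressure_normalisation⟩

/-! ## The discharge -/

/-- **Tao 2011, Lemma 8.1 (global energy inequality for finite energy smooth solutions)** —
discharge of the named fact `NS.tao_finite_energy_smooth_energy_bound`: for a classical finite
energy solution of the unforced Navier–Stokes system on `[0,T] × ℝ³`,
`sup_t ∫|u(t)|² + ν∫₀ᵀ∫|∇u|² ≤ C ∫|u₀|²` with an absolute constant `C`. All inputs are now
theorems of the tree: layers 1–5 above and Tao's pressure normalisation (Lemma 4.1 (i),
`tao_pressure_normalisation_holds`). [cite: Tao2011, Lemma 8.1] -/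
theorem tao_finite_energy_smooth_energy_bound_holds : tao_finite_energy_smooth_energy_bound :=
  tao_finite_energy_smooth_energy_bound_of_pressure_normalisation tao_pressure_normalisation_holds

end Literature.Analysis.FluidPDE

end
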